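import Mathlib.GroupTheory.Index
import Literature.AnabelianGeometry.SemiGraphs.ArithTemperedGroupOfOuterAction

/-!
# Congruence subgroups of an outer action at a finite level have finite index
# ([SemiAnbd] Def 5.1 (i)(a)(c), Prop 5.2 (i) p. 63)

Mochizuki, *Semi-graphs of anabelioids*, Publ. RIMS **42** (2006) 221–322, Def 5.1 (i) p. 62
("(a) `π̂₁(A)` is topologically finitely generated", "(c) … `H → Out(π̂₁(𝒢_v))` … is continuous"),
Prop 5.2 (i)/(ii) p. 63 [cite: MochizukiSemiAnbd2006, Prop 5.2 (i), p. 63].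

PROOF-ONLY (no definitions, no named facts; row T54-B-top of the producer debt T54-B,
`HOME/plan/GAP-LEDGER.md` G-w4d053-1 and G-L3d2g2-1; seat abc-iut-L3-d2).  For an outer action
`ρ : Π_A → Out(Π)` and a `ρ`-stable normal subgroup `N ≤ Π` of FINITE index, the CONGRUENCE set
`C_N = {a | some representative α of ρ a satisfies α y · y⁻¹ ∈ N for all y}` is the kernel of the induced
homomorphism `Π_A → Out(Π ⧸ N)` into a FINITE group, hence a subgroup of finite index
(`exists_congruence_ker`).  Consequently, if every finite-index subgroup of `Π_A` is open — the
property of topologically finitely generated profinite groups (Def 5.1 (i)(a); Nikolov–Segal, recorded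
as GAP row G-L3d2g2-1, here an explicit HYPOTHESIS `hfio`, no fact is asserted) — then `ρ` is
congruence-continuous at `N` (`congruent_reps_nhds_of_finiteIndexOpen`), which is exactly the input
`hCC` of `TemperedExtension.finite_translates_of_congruent_reps` (the tower's binder `hfin`) and, at the
finite Galois levels, of `SubgroupPresentation.isOpen_map_levelKer_of_congruent_lifts`.

Nothing here refers to the IUT corpus; no side is taken on [IUTchIII] Cor 3.12; typed ≠ proved.
-/

namespace Literature.AnabelianGeometry.SemiGraphs

namespace TemperedExtension

open Literature.AnabelianGeometry.EtaleTheta Topology Filter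

universe u w

variable {G : Type u} [Group G] [TopologicalSpace G] [IsTopologicalGroup G]
  {PA : Type w} [Group PA] [TopologicalSpace PA]
  (ρ : PA →* TopOut G) (N : Subgroup G) [N.Normal]

omit [IsTopologicalGroup G] in
/-- Representatives of one outer class induce automorphisms of `Π ⧸ N` in one `Inn(Π ⧸ N)`-class.
[cite: MochizukiSemiAnbd2006, Prop 5.2 (i), p. 63] -/
private theorem mk_barAut_eq_of_mk_eq (α β : contMulAut G)
    (hα : N.map ((α : MulAut G) : G →* G) = N) (hβ : N.map ((β : MulAut G) : G →* G) = N)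
    (h : TopOut.mk G α = TopOut.mk G β) :
    (QuotientGroup.mk (QuotientGroup.congr N N (α : MulAut G) hα) : Out (G ⧸ N)) = QuotientGroup.mk (QuotientGroup.congr N N (β : MulAut G) hβ) := by
  obtain ⟨g, hg⟩ := exists_conj_of_mk_eq α β h
  rw [QuotientGroup.eq]
  refine ⟨QuotientGroup.mk ((α : MulAut G).symm g), MulEquiv.ext fun q => ?_⟩
  obtain ⟨x, rfl⟩ := QuotientGroup.mk_surjective q
  change (QuotientGroup.mk ((α : MulAut G).symm g) : G ⧸ N) * QuotientGroup.mk x *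
      (QuotientGroup.mk ((α : MulAut G).symm g))⁻¹ =
    QuotientGroup.mk ((α : MulAut G).symm ((β : MulAut G) x))
  rw [← QuotientGroup.mk_inv, ← QuotientGroup.mk_mul, ← QuotientGroup.mk_mul, hg x, map_mul, map_mul,
    map_inv, MulEquiv.symm_apply_apply]

omit [TopologicalSpace PA] in
/-- **The congruence set at a finite `ρ`-stable level is the kernel of a homomorphism to the finite
group `Out(Π ⧸ N)`**, hence a subgroup of finite index: there is `C : Subgroup Π_A` of finite index
whose elements are exactly the `a` admitting a representative `α` of `ρ a` with `α y · y⁻¹ ∈ N` for all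
`y`. [cite: MochizukiSemiAnbd2006, Prop 5.2 (i), p. 63] -/
theorem exists_congruence_ker [Finite (G ⧸ N)]
    (hstab : ∀ (a : PA) (α : contMulAut G), TopOut.mk G α = ρ a →
      N.map ((α : MulAut G) : G →* G) = N) :
    ∃ C : Subgroup PA, C.FiniteIndex ∧
      ∀ a : PA, a ∈ C ↔ ∃ α : contMulAut G, TopOut.mk G α = ρ a ∧
        ∀ y : G, (α : MulAut G) y * y⁻¹ ∈ N := by
  classical
  -- choose representatives
  have hrep : ∀ a : PA, ∃ α : contMulAut G, TopOut.mk G α = ρ a := fun a =>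
    QuotientGroup.mk'_surjective _ (ρ a)
  choose rep hrep using hrep
  -- the induced map to `Out(Π ⧸ N)`
  let θf : PA → Out (G ⧸ N) := fun a =>
    QuotientGroup.mk (QuotientGroup.congr N N ((rep a : contMulAut G) : MulAut G) (hstab a _ (hrep a)))
  -- independence of the representative
  have hθ : ∀ (a : PA) (α : contMulAut G) (hα : TopOut.mk G α = ρ a),
      θf a = QuotientGroup.mk (QuotientGroup.congr N N (α : MulAut G) (hstab a α hα)) := fun a α hα =>
    mk_barAut_eq_of_mk_eq N _ _ _ _ ((hrep a).trans hα.symm)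
  -- multiplicativity: `rep a * rep b` represents `ρ (a * b)`
  have hmul : ∀ a b : PA, θf (a * b) = θf a * θf b := by
    intro a b
    have hab : TopOut.mk G (rep a * rep b) = ρ (a * b) := by rw [map_mul, hrep, hrep, map_mul]
    rw [hθ (a * b) (rep a * rep b) hab]
    change _ = QuotientGroup.mk _ * QuotientGroup.mk _
    rw [← QuotientGroup.mk_mul]
    congr 1
    refine MulEquiv.ext fun q => ?_
    obtain ⟨x, rfl⟩ := QuotientGroup.mk_surjective q
    rfl
  let θ : PA →* Out (G ⧸ N) := MonoidHom.mk' θf hmul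
  -- `Out(Π ⧸ N)` is finite, so the kernel has finite index
  haveI : Finite (MulAut (G ⧸ N)) :=
    Finite.of_injective (fun e : MulAut (G ⧸ N) => (e : G ⧸ N → G ⧸ N)) DFunLike.coe_injective
  haveI : Finite (Out (G ⧸ N)) := by
    change Finite (MulAut (G ⧸ N) ⧸ innerAut (G ⧸ N))
    infer_instance
  refine ⟨θ.ker, ⟨?_⟩, fun a => ?_⟩
  · rw [Subgroup.index_ker]
    exact Nat.card_pos.ne'
  · rw [MonoidHom.mem_ker]
    change θf a = 1 ↔ _
    constructor
    · intro ha
      -- `congr (rep a)` is inner, say conjugation by `ḡ`; then `conj g⁻¹ ∘ rep a ≡ id (mod N)`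
      have ha' : (QuotientGroup.mk (QuotientGroup.congr N N ((rep a : contMulAut G) : MulAut G) (hstab a _ (hrep a))) : Out (G ⧸ N)) = 1 := ha
      rw [QuotientGroup.eq_one_iff] at ha'
      obtain ⟨q, hq⟩ := ha'
      obtain ⟨g, rfl⟩ := QuotientGroup.mk_surjective q
      let γ : contMulAut G := ⟨MulAut.conj g⁻¹, innerAut_le_contMulAut G ⟨g⁻¹, rfl⟩⟩
      refine ⟨γ * rep a, ?_, fun y => ?_⟩
      · rw [map_mul, hrep]
        have : TopOut.mk G γ = 1 := by
          rw [QuotientGroup.mk'_apply, QuotientGroup.eq_one_iff]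
          exact ⟨g⁻¹, rfl⟩
        rw [this, one_mul]
      · -- from `conj ḡ = congr (rep a)`: `g y g⁻¹ ≡ rep a y (mod N)`
        have hy : (QuotientGroup.mk (g * y * g⁻¹) : G ⧸ N) =
            QuotientGroup.mk (((rep a : contMulAut G) : MulAut G) y) := by
          have := MulEquiv.congr_fun hq (QuotientGroup.mk y)
          simpa only [MulAut.conj_apply, QuotientGroup.congr_mk, ← QuotientGroup.mk_mul,
            ← QuotientGroup.mk_inv] using this
        rw [QuotientGroup.eq] at hy
        -- `γ (rep a y) * y⁻¹ = g⁻¹ (rep a y) g y⁻¹ = (y g⁻¹)⁻¹ · [(g y g⁻¹)⁻¹ rep a y] · (y g⁻¹)`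
        have : ((γ * rep a : contMulAut G) : MulAut G) y * y⁻¹ =
            (g * y⁻¹)⁻¹ * ((g * y * g⁻¹)⁻¹ * ((rep a : contMulAut G) : MulAut G) y) * (g * y⁻¹) := by
          change g⁻¹ * ((rep a : contMulAut G) : MulAut G) y * g⁻¹⁻¹ * y⁻¹ = _
          group
        rw [this]
        exact Subgroup.Normal.conj_mem' inferInstance _ hy _
    · rintro ⟨α, hα, hcong⟩
      rw [hθ a α hα, ← QuotientGroup.mk_one]
      congr 1
      refine MulEquiv.ext fun q => ?_
      obtain ⟨x, rfl⟩ := QuotientGroup.mk_surjective q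
      rw [QuotientGroup.congr_mk, MulAut.one_apply, QuotientGroup.eq]
      -- `(α x)⁻¹ x ∈ N` from `α x · x⁻¹ ∈ N`
      have h := Subgroup.Normal.conj_mem' inferInstance _ (hcong x) x
      have h' : x⁻¹ * (α : MulAut G) x ∈ N := by simpa [mul_assoc] using h
      have : ((α : MulAut G) x)⁻¹ * x = (x⁻¹ * (α : MulAut G) x)⁻¹ := by group
      rw [this]
      exact N.inv_mem h'

/-- **Congruence-continuity at a finite level from "finite-index subgroups are open"**: if every
finite-index subgroup of `Π_A` is open (topologically finitely generated profinite groups, Def 5.1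
(i)(a) via Nikolov–Segal — an explicit HYPOTHESIS here), then for every finite `ρ`-stable normal level
`N` some neighbourhood of `1` in `Π_A` consists of elements with a representative `≡ id (mod N)` — the
input `hCC` of `finite_translates_of_congruent_reps` and of the finite-level `hK1′` reduction.
[cite: MochizukiSemiAnbd2006, Prop 5.2 (i), p. 63] -/
theorem congruent_reps_nhds_of_finiteIndexOpen [ContinuousMul PA] [Finite (G ⧸ N)]
    (hfio : ∀ U : Subgroup PA, U.FiniteIndex → IsOpen (U : Set PA))
    (hstab : ∀ (a : PA) (α : contMulAut G), TopOut.mk G α = ρ a →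
      N.map ((α : MulAut G) : G →* G) = N) :
    ∃ U ∈ 𝓝 (1 : PA), ∀ u ∈ U, ∃ β : contMulAut G,
      TopOut.mk G β = ρ u ∧ ∀ y : G, (β : MulAut G) y * y⁻¹ ∈ N := by
  obtain ⟨C, hC, hmem⟩ := exists_congruence_ker ρ N hstab
  exact ⟨C, (hfio C hC).mem_nhds C.one_mem, fun u hu => (hmem u).mp hu⟩

end TemperedExtension

end Literature.AnabelianGeometry.SemiGraphs
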